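import Summits.ResolutionOfSingularities.KangarooAtlas.MizutaniExtremalOdd
import Summits.ResolutionOfSingularities.KangarooAtlas.MizutaniLemma29Converse
import HarnessLib

/-!
# Mizutani's Thm. 2.8, second part, for odd `p`: «the same type as Example 2.1», modulo Lemma 2.9 (2) in tower form

Cell `pub-rosobs`, Mizutani enclosure (seat mizutani-encloser-2, gen 7). AI-written; AI review is weaker than expert
review; NOT a resolution-of-singularities theorem (summit relevance C).

Mizutani (Nagoya Math. J. 52 (1973) p. 92): «We may assume `c(f) ∋ 1`.  Hence by Lemma 2.9 below there exists `D₀` in `Der(K/k^p)` such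
that `D = u·D₀²` with `u ∈ K` and `D₀(c₁) = 0`, `D₀(c₂) = 1` where `K = k^p(c₁, c₂)`.  Thus `c(f) = ker D = k^p(c₁) ⊕ k^p(c₁)c₂` and `H` is
of the same type as Example 2.1.»  `MizutaniExtremalOdd.exists_annihilator_of_extremal` gives, for the extremal point with `p` odd, the
two-generator tower `k^p(y_1, y_2)`, a second-order `D ≠ 0` with `D(1) = D(y_j) = 0` and `ker D = span_{k^p}{c_i}` of dimension `2p`;
encloser-1's `IsRootTower.ker_eq_span_of_eq_smul_comp` (`MizutaniLemma29Converse.lean`) computes `ker (u·D₀∘D₀) = ⊕_{m<p, j≤1} k^p c₀'^m c₁'^j`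
for a `p`-basis `(c₀', c₁')` with `D₀ c₀' = 0`, `D₀ c₁' = 1`.  This file composes the two MODULO the «only if» half of Lemma 2.9 (2) in tower
form — taken here as an explicit HYPOTHESIS `hL29` (its proof, only outlined in print, is being formalised by encloser-1 g7:
`MizutaniLemma29Cases/Count/Heat`, `MizutaniWaveKernel`); instantiating `hL29` with that theorem yields the unconditional statement:

* **`span_coords_eq_of_extremal_of_lemma29`** — `p` odd, extremal point (no linear form, `(L_B)_1 ≠ 0`, `n + 2 = 2p + dim (L_B)_1`), and
  Lemma 2.9 (2) «⇒» for the tower `k^p(y_1,y_2)`: then `n + 1 = 2p`, `𝔭 = [c^{1/p}]` with `c_0 = 1`, and for a `p`-basis `(c₀', c₁')` of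
  `k^p(y_1,y_2) = k^p(c)` over `k^p`:  **`span_{k^p}{c_i} = ⊕_{m < p, j ≤ 1} k^p · c₀'^m c₁'^j`** `= k^p(c₀') ⊕ k^p(c₀')·c₁'`
  («`c(f) = k^p(c₁) ⊕ k^p(c₁)c₂`»: the type of Example 2.1).

## References

* H. Mizutani, *Hironaka's additive group schemes*, Nagoya Math. J. 52 (1973) 85–95, Thm. 2.8 (second part), Step (I) (p. 92), Lemma 2.9 (2).
  [Mizutani1973HironakaGroupSchemes]
-/

noncomputable section

open MvPolynomial TensorProduct Literature.AlgebraicGeometry.Resolution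
  Literature.AlgebraicGeometry.Resolution.HironakaScheme

namespace Summit.ResolutionOfSingularities.KangarooAtlas.Mizutani

universe u

section TypeStatement

variable (k : Type u) [Field k] (p : ℕ) [hp : Fact p.Prime] [CharP k p] {n : ℕ}
  (𝔭 : Ideal (MvPolynomial (Fin (n + 1)) k))

/-- **THM. 2.8, SECOND PART, ODD `p`, «SAME TYPE AS EXAMPLE 2.1» — modulo Lemma 2.9 (2) «⇒» in tower form (hypothesis `hL29`).**
For an extremal point (`p ≠ 2`, no linear form, `(L_B)_1 ≠ 0`, `n + 2 = 2p + dim (L_B)_1`): `n + 1 = 2p`, `𝔭 = [c^{1/p}]` (`c_0 = 1`,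
`c` `k^p`-independent), `{c_i} ⊆ k^p(y_1, y_2)` for a `p`-independent pair `y ⊆ {c_i}`, and for some `p`-basis `(c₀', c₁')` of `k^p(y_1,y_2)/k^p`
(a root-tower presentation) the `k^p`-span of the coordinates is `⊕_{m<p, j≤1} k^p·c₀'^m c₁'^j = k^p(c₀') ⊕ k^p(c₀')·c₁'`.
[cite: Mizutani1973HironakaGroupSchemes, Thm. 2.8 (second part) and its proof, Step (I) («c(f) = ker D = k^p(c₁) ⊕ k^p(c₁)c₂»), Lemma 2.9 (2)] -/
theorem span_coords_eq_of_extremal_of_lemma29 (hp2 : p ≠ 2) (hP : IsPoint k 𝔭) (h0 : invForms k p 𝔭 0 = ⊥)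
    (hV : invForms k p 𝔭 1 ≠ ⊥) (hdim : n + 2 = 2 * p + Module.finrank k (invForms k p 𝔭 1))
    (hL29 : ∀ (y : Fin 2 → k) (hy : PIndep p 1 y) (D : towerField 1 y →ₗ[frobPow k p 1] towerField 1 y),
      IsDiffOpLE (frobPow k p 1) 2 D → D ≠ 0 → D 1 = 0 → (∀ j, D (towerGen 1 y j) = 0) →
      Module.finrank (frobPow k p 1) (LinearMap.ker D) = 2 * p →
      ∃ (x' : Fin 2 → frobPow k p 1) (c' : Fin 2 → towerField 1 y)
        (_ : IsRootTower (frobPow k p 1) (towerField 1 y) (p ^ 1) x' c')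
        (D₀ : Derivation (frobPow k p 1) (towerField 1 y) (towerField 1 y)) (u : towerField 1 y),
        D₀ (c' 0) = 0 ∧ D₀ (c' 1) = 1 ∧
          D = u • ((D₀ : towerField 1 y →ₗ[frobPow k p 1] towerField 1 y) ∘ₗ
            (D₀ : towerField 1 y →ₗ[frobPow k p 1] towerField 1 y))) :
    n + 1 = 2 * p ∧ ∃ (c : Fin (n + 1) → k) (y : Fin 2 → k) (_ : PIndep p 1 y) (hc : ∀ i, c i ∈ towerField 1 y)
      (x' : Fin 2 → frobPow k p 1) (c' : Fin 2 → towerField 1 y)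
      (_ : IsRootTower (frobPow k p 1) (towerField 1 y) (p ^ 1) x' c'),
      c 0 = 1 ∧ LinearIndependent (frobPow k p 1) c ∧ 𝔭 = ratPoint k p 1 c ∧ Set.range y ⊆ Set.range c ∧
      Submodule.span (frobPow k p 1) (Set.range fun i => (⟨c i, hc i⟩ : towerField 1 y)) =
        Submodule.span (frobPow k p 1) (Set.range fun mj : Fin p × Fin 2 => c' 0 ^ (mj.1 : ℕ) * c' 1 ^ (mj.2 : ℕ)) := by
  obtain ⟨c, y, hy, hc, ν, D, hc0, hcind, heq, hyc, -, hDord, hD0, hD1, hDa, -, hn, hker, hkereq⟩ :=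
    exists_annihilator_of_extremal k p 𝔭 hp2 hP h0 hV hdim
  obtain ⟨x', c', h'', D₀, u, hD₀0, hD₀1, hDeq⟩ := hL29 y hy D hDord hD0 hD1 hDa hker
  have hu : u ≠ 0 := by
    rintro rfl
    exact hD0 (by rw [hDeq, zero_smul])
  refine ⟨hn, c, y, hy, hc, x', c', h'', hc0, hcind, heq, hyc, ?_⟩
  rw [← hkereq]
  exact h''.ker_eq_span_of_eq_smul_comp hp2 D₀ hD₀0 hD₀1 hu hDeq

end TypeStatement

end Summit.ResolutionOfSingularities.KangarooAtlas.Mizutani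

end
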